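import Summits.ABC.IUTFork.LDHGenuinePerImagePrintIsm
import Summits.ABC.IUTFork.LDHGenuinePerImageBroberg
import Summits.ABC.IUTFork.BrobergCondP6
import Mathlib.Analysis.Complex.ExponentialBounds
import HarnessLib

/-!
# The fork at [IUTchIII] Corollary 3.12, L-DH level: the per-image inequality with Θ-side over PRINT's (Ind2) FAILS at an
# INHABITED genuine datum — Broberg's quadratic point `λ = (8 − 3√7)/16`, `l = 7` (and every prime `l ≥ 5`, `l ≠ 47`)
# (abc-iut cell, crux ThetaPartII = stmt-ABC-19678; row «C:PERIMAGE-PRINT-ISM», part 3: the WITNESS)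

Record-only PROOF file (D-0012; no definition, no `Prop` fact) of the abc-iut cell (WAVE-3 discharge seat abc-iut-c312-d1, gen 11; sequel of
`LDHGenuinePrintIsmPacket` (p509534) and `LDHGenuinePerImagePrintIsm`). TAKES NO SIDE on [IUTchIII] Cor. 3.12.

`LDHGenuinePerImagePrintIsm` proved: at the Θ-data of a `λ`-line point `P ∈ U` and a prime `l ≥ 5` with `log q^{∤{2,l}}(λ) ≥ 24`, for EVERY
genuine datum `T` and EVERY family `H` of packet automorphisms DOMINATED BY PRINT's (Ind2) (factorwise abc-iut-c312-1 `Real.ismIsm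
(analyticLogv K) v̲_b` = `ℤ_p^×·id`, abc-iut-w5-d216 p452975), the per-image inequality `−|log(q)| ≤ [Θ-side over H] + ((l+5)/4)·log π` is
FALSE (`Cor22.ThetaVolumeDatumAt.not_perImage_printInd2_of_le`). THIS FILE exhibits INHABITED instances, so that the failure is not vacuous:

* `Broberg.twentyfour_le_logQAvoid_pair` — at abc-iut-W-row-2's Broberg point over `ℚ(√7)` (`Broberg.point`; bad places `𝔭₃, 𝔭₃', 𝔭₄₇`):
  `log q^{∤{2,l}}(λ) = 13·log 3 + 4·log 47 ≥ 24` for every prime `l ∉ {3, 47}` (abc-iut-C-cert-2 `Broberg.logQAvoid_pair_of_ne`; `log 3 > 1`,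
  `log 47 > 3` from Mathlib's `Real.exp_one_lt_d9`, inlined);
* **`Broberg.not_perImage_printInd2`** — for every prime `l ≥ 5`, `l ≠ 47`, every genuine datum `T : ThetaVolumeDatumAt Broberg.point l` and
  every print-dominated `H`: the per-image inequality over print's (Ind2) FAILS;
* **`Broberg.nonempty_and_not_perImage_printInd2_seven`** / **`…_eleven`** — AND the datum types at `l = 7`, `l = 11` are INHABITED
  UNCONDITIONALLY (abc-iut-W-row-2 `Broberg.nonempty_thetaVolumeDatumAt_seven/_eleven`, p-ids of `BrobergCondP6`): there EXIST genuine Θ-data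
  at which, for every print-dominated `H`, the (P)-form of [IUTchIII] Cor. 3.12 with the Θ-side computed over print's factorwise `Ism` is false.

READING (about OUR typings; the C LEAD's words decide the booking): «[IUTchIII] Cor. 3.12 in the cell's per-image reading (P) with (Ind2) :=
PRINT's factorwise `Ism` as typed by abc-iut-c312-1 (realised through the logarithm; = unit homotheties) — instead of the Dupuy–Hilado container —
is REFUTED AS TYPED as a statement quantified over all genuine Θ-data: witness (Broberg's point, l = 7)»; under the CONTAINER the same typed
Corollary HOLDS at (Broberg, l ≥ 17) (abc-iut-C-cert-2 `Broberg.cor312PerImageOf_of_seventeen_le`) and in reading (U) at `l = 7, 11`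
(abc-iut-C-cert-3 `Broberg.cor312Of_seven/_eleven`). Which of the two is print's EFFECTIVE (Ind2) at `v ∈ 𝕍^bad` is referee finding F-B28-1's
reading matter; (Ind1), (Ind3), the log-link and Cor. 3.12 itself are untouched; refuted-as-typed ≠ refuted in print; nothing here asserts that
abc is proved or refuted; no side taken. [cite: Mochizuki2012, IUTchIII Cor. 3.12 p. 173–174; Thm. 3.11 (i) p. 154] [cite: Mochizuki2012, IUTchIV
Thm. 1.10 p. 23; Cor. 2.2 (ii) p. 46] [cite: Mochizuki2012, IUTchII Ex. 1.8 (iv) p. 39] [cite: DupuyHilado2025, §4.9, §4.12]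
[claim: Mochizuki2012, status: disputed] for every IUT quotation. Axioms: standard three.
-/

noncomputable section

open NumberField IsDedekindDomain

namespace Summit.ABC.IUTFork.Broberg

open Literature.IUT.LogVolume Literature.IUT.LogVolume.Cor22 Literature.NumberTheory.NumberFields Thm311.Real
open Literature.NumberTheory.DiophantineGeometry.GenEll

/-! ## 1. `log q^{∤{2,l}}(λ_Broberg) ≥ 24` -/

/-- **`24 ≤ log q^{∤{2,l}}(λ)` at Broberg's point** for every prime `l ∉ {3, 47}`: `13·log 3 + 4·log 47 > 13·1 + 4·3` (`e < 3`, `e³ < 47`,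
Mathlib's `Real.exp_one_lt_d9`; abc-iut-C-cert-2 `logQAvoid_pair_of_ne`). [cite: Mochizuki2012, IUTchIV Thm. 1.10 p. 23]
[claim: Mochizuki2012, status: disputed] -/
theorem twentyfour_le_logQAvoid_pair {l : ℕ} (hl : l.Prime) (h3 : l ≠ 3) (h47 : l ≠ 47) : 24 ≤ logQAvoid point {2, l} := by
  rw [logQAvoid_pair_of_ne hl h3 h47]
  have he := Real.exp_one_lt_d9
  have h0 : 0 < Real.exp 1 := Real.exp_pos 1
  -- `1 < log 3`
  have hlog3 : (1 : ℝ) < Real.log 3 := by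
    rw [Real.lt_log_iff_exp_lt (by norm_num)]
    linarith
  -- `3 < log 47`
  have hlog47 : (3 : ℝ) < Real.log 47 := by
    rw [Real.lt_log_iff_exp_lt (by norm_num)]
    have h3' : Real.exp 3 = Real.exp 1 ^ 3 := by rw [← Real.exp_nat_mul]; norm_num
    rw [h3']
    nlinarith [mul_pos h0 h0]
  linarith

/-! ## 2. The per-image inequality over print's (Ind2) fails at every Broberg datum, `l ≥ 5`, `l ≠ 47` -/

/-- **At Broberg's point, for every prime `l ≥ 5`, `l ≠ 47`, every genuine datum `T` and every family `H` of packet automorphisms DOMINATED BY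
PRINT's (Ind2)** (factorwise abc-iut-c312-1 `Real.ismIsm (analyticLogv K) v̲_b`): the per-image inequality with Θ-side computed over `H` FAILS
(`not_perImage_printInd2_of_le` with `λ ∈ U` = `Broberg.point_inU` and `log q^{∤{2,l}} ≥ 24`).
[cite: Mochizuki2012, IUTchIII Cor. 3.12 p. 173–174; Thm. 3.11 (i) p. 154] [claim: Mochizuki2012, status: disputed] -/
theorem not_perImage_printInd2 {l : ℕ} (hl : l.Prime) (h5 : 5 ≤ l) (h47 : l ≠ 47) (T : ThetaVolumeDatumAt point l) :
    letI := T.instFieldF; letI := T.instNumberFieldF; letI := T.instFieldK; letI := T.instNumberFieldK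
    letI := T.instAlgebraK; letI := T.instIsElliptic
    ∀ (H : (p : ℕ) → (hp : p.Prime) → (j : ℕ) →
        (e : Fin (j + 1) → placesOver (Literature.IUT.HodgeTheaters.fieldOfModuli T.E) p) →
        haveI : Fact p.Prime := ⟨hp⟩
        Subgroup (PacketAlgebra p (fun b => (T.I.σ.localFields p).k (e b)) ≃ₗ[ℚ_[p]]
          PacketAlgebra p (fun b => (T.I.σ.localFields p).k (e b)))),
      (∀ (p : ℕ) (hp : p.Prime), haveI : Fact p.Prime := ⟨hp⟩
        ∀ j e, ∀ g ∈ H p hp j e,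
          ∃ ψ : ∀ b : Fin (j + 1), Carrier (.inr (T.I.σ.lift (e b).1) : Thm311.Real.Place T.K) ≃ₗ[ℚ]
              Carrier (.inr (T.I.σ.lift (e b).1) : Thm311.Real.Place T.K),
            (∀ b, ψ b ∈ ismIsm (analyticLogv T.K) (T.I.σ.lift (e b).1)) ∧
            ∀ x : ∀ b, (T.I.σ.localFields p).k (e b),
              (g : PacketAlgebra p (fun b => (T.I.σ.localFields p).k (e b)) ≃ₗ[ℚ_[p]]
                  PacketAlgebra p (fun b => (T.I.σ.localFields p).k (e b))) (PiTensorProduct.tprod ℚ_[p] x) =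
                PiTensorProduct.tprod ℚ_[p] (fun b =>
                  RescaledCompletion.of T.K p (T.I.σ.lift (e b).1) (T.I.σ.natCast_mem_lift (e b))
                    (ψ b ((RescaledCompletion.of T.K p (T.I.σ.lift (e b).1) (T.I.σ.natCast_mem_lift (e b))).symm (x b))))) →
      ¬ (T.negAbsLogQ ≤
          (∑ p ∈ T.I.supportPrimes,
            if hp : p.Prime then
              (haveI : Fact p.Prime := ⟨hp⟩
               (T.I.packetAt p hp).lnνLp T.I.lstar (fun j e =>
                 packetHull p (fun b => (T.I.σ.localFields p).k (e b))
                   (⋃ g : H p hp j e, (g : PacketAlgebra p (fun b => (T.I.σ.localFields p).k (e b)) ≃ₗ[ℚ_[p]]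
                       PacketAlgebra p (fun b => (T.I.σ.localFields p).k (e b))) ''
                     (T.I.packetAt p hp).pilotRegion (T.I.tΘ p hp) j e)))
            else 0) + ThetaVolumeInput.archLogTheta l) := by
  have h3 : l ≠ 3 := by omega
  exact T.not_perImage_printInd2_of_le point_inU h5 (twentyfour_le_logQAvoid_pair hl h3 h47)

/-! ## 3. INHABITED witnesses: `l = 7` and `l = 11` -/

/-- **WITNESS AT `l = 7`: the datum type `ThetaVolumeDatumAt Broberg.point 7` is INHABITED (abc-iut-W-row-2, unconditional) AND at every one
of its data the per-image inequality over PRINT's (Ind2) FAILS for every print-dominated `H`** — so «∀ genuine Θ-data, the (P)-inequality with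
Θ-side over print's factorwise `Ism`» is false AS TYPED, with an exhibited datum. [cite: Mochizuki2012, IUTchIII Cor. 3.12 p. 173–174]
[cite: Mochizuki2012, IUTchIV Cor. 2.2 (ii) proof (P7) p. 46] [claim: Mochizuki2012, status: disputed] -/
theorem nonempty_and_not_perImage_printInd2_seven :
    Nonempty (ThetaVolumeDatumAt point 7) ∧
    ∀ T : ThetaVolumeDatumAt point 7,
    letI := T.instFieldF; letI := T.instNumberFieldF; letI := T.instFieldK; letI := T.instNumberFieldK
    letI := T.instAlgebraK; letI := T.instIsElliptic
    ∀ (H : (p : ℕ) → (hp : p.Prime) → (j : ℕ) →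
        (e : Fin (j + 1) → placesOver (Literature.IUT.HodgeTheaters.fieldOfModuli T.E) p) →
        haveI : Fact p.Prime := ⟨hp⟩
        Subgroup (PacketAlgebra p (fun b => (T.I.σ.localFields p).k (e b)) ≃ₗ[ℚ_[p]]
          PacketAlgebra p (fun b => (T.I.σ.localFields p).k (e b)))),
      (∀ (p : ℕ) (hp : p.Prime), haveI : Fact p.Prime := ⟨hp⟩
        ∀ j e, ∀ g ∈ H p hp j e,
          ∃ ψ : ∀ b : Fin (j + 1), Carrier (.inr (T.I.σ.lift (e b).1) : Thm311.Real.Place T.K) ≃ₗ[ℚ]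
              Carrier (.inr (T.I.σ.lift (e b).1) : Thm311.Real.Place T.K),
            (∀ b, ψ b ∈ ismIsm (analyticLogv T.K) (T.I.σ.lift (e b).1)) ∧
            ∀ x : ∀ b, (T.I.σ.localFields p).k (e b),
              (g : PacketAlgebra p (fun b => (T.I.σ.localFields p).k (e b)) ≃ₗ[ℚ_[p]]
                  PacketAlgebra p (fun b => (T.I.σ.localFields p).k (e b))) (PiTensorProduct.tprod ℚ_[p] x) =
                PiTensorProduct.tprod ℚ_[p] (fun b =>
                  RescaledCompletion.of T.K p (T.I.σ.lift (e b).1) (T.I.σ.natCast_mem_lift (e b))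
                    (ψ b ((RescaledCompletion.of T.K p (T.I.σ.lift (e b).1) (T.I.σ.natCast_mem_lift (e b))).symm (x b))))) →
      ¬ (T.negAbsLogQ ≤
          (∑ p ∈ T.I.supportPrimes,
            if hp : p.Prime then
              (haveI : Fact p.Prime := ⟨hp⟩
               (T.I.packetAt p hp).lnνLp T.I.lstar (fun j e =>
                 packetHull p (fun b => (T.I.σ.localFields p).k (e b))
                   (⋃ g : H p hp j e, (g : PacketAlgebra p (fun b => (T.I.σ.localFields p).k (e b)) ≃ₗ[ℚ_[p]]
                       PacketAlgebra p (fun b => (T.I.σ.localFields p).k (e b))) ''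
                     (T.I.packetAt p hp).pilotRegion (T.I.tΘ p hp) j e)))
            else 0) + ThetaVolumeInput.archLogTheta 7) :=
  ⟨nonempty_thetaVolumeDatumAt_seven, fun T => not_perImage_printInd2 (by norm_num) (by norm_num) (by norm_num) T⟩

/-- **WITNESS AT `l = 11`** (same, `Broberg.nonempty_thetaVolumeDatumAt_eleven`). [cite: Mochizuki2012, IUTchIII Cor. 3.12 p. 173–174]
[cite: Mochizuki2012, IUTchIV Cor. 2.2 (ii) proof (P7) p. 46] [claim: Mochizuki2012, status: disputed] -/
theorem nonempty_and_not_perImage_printInd2_eleven :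
    Nonempty (ThetaVolumeDatumAt point 11) ∧
    ∀ T : ThetaVolumeDatumAt point 11,
    letI := T.instFieldF; letI := T.instNumberFieldF; letI := T.instFieldK; letI := T.instNumberFieldK
    letI := T.instAlgebraK; letI := T.instIsElliptic
    ∀ (H : (p : ℕ) → (hp : p.Prime) → (j : ℕ) →
        (e : Fin (j + 1) → placesOver (Literature.IUT.HodgeTheaters.fieldOfModuli T.E) p) →
        haveI : Fact p.Prime := ⟨hp⟩
        Subgroup (PacketAlgebra p (fun b => (T.I.σ.localFields p).k (e b)) ≃ₗ[ℚ_[p]]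
          PacketAlgebra p (fun b => (T.I.σ.localFields p).k (e b)))),
      (∀ (p : ℕ) (hp : p.Prime), haveI : Fact p.Prime := ⟨hp⟩
        ∀ j e, ∀ g ∈ H p hp j e,
          ∃ ψ : ∀ b : Fin (j + 1), Carrier (.inr (T.I.σ.lift (e b).1) : Thm311.Real.Place T.K) ≃ₗ[ℚ]
              Carrier (.inr (T.I.σ.lift (e b).1) : Thm311.Real.Place T.K),
            (∀ b, ψ b ∈ ismIsm (analyticLogv T.K) (T.I.σ.lift (e b).1)) ∧
            ∀ x : ∀ b, (T.I.σ.localFields p).k (e b),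
              (g : PacketAlgebra p (fun b => (T.I.σ.localFields p).k (e b)) ≃ₗ[ℚ_[p]]
                  PacketAlgebra p (fun b => (T.I.σ.localFields p).k (e b))) (PiTensorProduct.tprod ℚ_[p] x) =
                PiTensorProduct.tprod ℚ_[p] (fun b =>
                  RescaledCompletion.of T.K p (T.I.σ.lift (e b).1) (T.I.σ.natCast_mem_lift (e b))
                    (ψ b ((RescaledCompletion.of T.K p (T.I.σ.lift (e b).1) (T.I.σ.natCast_mem_lift (e b))).symm (x b))))) →
      ¬ (T.negAbsLogQ ≤
          (∑ p ∈ T.I.supportPrimes,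
            if hp : p.Prime then
              (haveI : Fact p.Prime := ⟨hp⟩
               (T.I.packetAt p hp).lnνLp T.I.lstar (fun j e =>
                 packetHull p (fun b => (T.I.σ.localFields p).k (e b))
                   (⋃ g : H p hp j e, (g : PacketAlgebra p (fun b => (T.I.σ.localFields p).k (e b)) ≃ₗ[ℚ_[p]]
                       PacketAlgebra p (fun b => (T.I.σ.localFields p).k (e b))) ''
                     (T.I.packetAt p hp).pilotRegion (T.I.tΘ p hp) j e)))
            else 0) + ThetaVolumeInput.archLogTheta 11) :=
  ⟨nonempty_thetaVolumeDatumAt_eleven, fun T => not_perImage_printInd2 (by norm_num) (by norm_num) (by norm_num) T⟩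

end Summit.ABC.IUTFork.Broberg

end
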